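import Summits.BirchSwinnertonDyer.BirchSwinnertonDyer.Theorems.EdixhovenFibreFiveSevenTypeGOrdManinUnitOfSL2NeronValuesBar
import Summits.BirchSwinnertonDyer.BirchSwinnertonDyer.Theorems.TeichmullerTwistDescentCellsOfCDT
import Summits.BirchSwinnertonDyer.BirchSwinnertonDyer.Theorems.EdixhovenFibreFiveSevenTwistDegreeStepOrdinaryOfSL2NeronValuesBar
import HarnessLib

/-!
# The rung W-ALL/2.p>=5.r1 through routes EdixhovenFibreFiveSeven, TeichmullerTwistDescent and AdditiveKolyvaginRoad, with the WHOLE Manin side replaced by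
# {P1-bar, modularity} — no Kato 1993 [REC-tower], no Calegari–Dimitrov–Tang, no F″, no Cremona range (seat `bsd-line-edix-p4` g31, width; joint with LEAD `bsd-line-edix-p1` g33)

HONEST FRAMING. Three tool theorems (no definition, no named fact, no instance, no `sorry`); helper `--supports` PSMU stmt-BirchSwinnertonDyer-22638 (route
TeichmullerTwistDescent; same rung as EdixhovenFibreFiveSeven / AdditiveKolyvaginRoad). CONDITIONAL: P1-bar (`Kato2004.exists_member_sl2ZetaElement_neron_values_bar`, print
XL, cite-only), the three AKR-shared OPEN Kolyvagin-side cruxes `KolyvaginPrimitiveAdditive` (21400), `RankZeroAdditive` (20133), `OffSharpRankOneAdditive` (20134), and the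
hypothesis-only published bundles; no item is closed; **BSD is not proved and no W-ALL class theorem is proved by this.**

WHAT. With `TypeGOrdManinUnitOfSL2NeronValuesBar` (this seat: PSMU / GE11 / AKR crux #7 ⟸ {modularity, P1-bar}), `PotGoodManinUnitOfSL2NeronValuesBar` (K★ / TDS57) and the LEAD's
`TwistDegreeStepOrdinaryOfSL2NeronValuesBar.twistDegreeStepOrdinary_of_sl2NeronValuesBar` (TDS11 ⟸ P1-bar, p809715) the three routes' deciding theorems run with their
Manin inputs DISCHARGED modulo P1-bar:

* ★★ `wAllExclAdditiveFiveLeRankOne_of_akr_of_sl2NeronValuesBar_viaEdixhovenFibreFiveSeven` — the RUNG through route EF57's `EdixhovenFibreFiveSevenAssembly.assembly_proof`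
  (K★, TDS57, TDS11 all ⟸ P1-bar; closed glue G57): `PotGoodManinUnitOfSL2NeronValuesBar.wAllExclAdditiveFiveLeRankOne_of_akr_of_twistDegreeStepOrdinary_of_sl2NeronValuesBar`
  with `hO := twistDegreeStepOrdinary_of_sl2NeronValuesBar hP1` = g19's `…_of_akr_of_reciprocityLaw_of_sl2NeronValuesBar` WITHOUT `hrec`. GRANTED: P1-bar, 21400, 20133,
  20134, `PublishedInputsAdditiveKoly`, `PublishedManinFacts`.

* ★★ `wAllExclAdditiveFiveLeRankOne_of_akr_of_sl2NeronValuesBar_viaTeichmullerTwistDescent` — the RUNG `Summit.BirchSwinnertonDyer.WAllExclAdditiveFiveLeRankOne` through route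
  TeichmullerTwistDescent's landed `TeichmullerTwistDescentAssembly.assembly_proof` fed with PSMU (`principalSeriesOptimalManinUnit_of_sl2NeronValuesBar`) and SCMU57
  (`supercuspidalOptimalManinUnitFiveSeven_of_sl2NeronValuesBar`) and the closed glue `WeilTypeManinGlue.weilTypeManinGlue_proof` — compare
  `TeichmullerTwistDescent.wAllExclAdditiveFiveLeRankOne_of_akr_of_CDT` (the same with Calegari–Dimitrov–Tang in place of P1-bar) and
  `PotGoodManinUnitOfSL2NeronValuesBar.wAllExclAdditiveFiveLeRankOne_of_akr_of_twistDegreeStepOrdinary_of_sl2NeronValuesBar` (route EF57, which still carries the item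
  TDS11). GRANTED: P1-bar, 21400, 20133, 20134, `PublishedInputsAdditiveKoly`, `PublishedManinFacts`. Neither [REC-tower] nor CDT nor `KatoNeronAndCremonaFacts` is a
  hypothesis.
* ★★ `wAllExclAdditive_of_closes_of_sl2NeronValuesBar` — the LEAF `Summit.BirchSwinnertonDyer.WAllExclAdditive` of route AdditiveKolyvaginRoad through its own `closes`
  with crux #7 `ManinFrameResidueProperR` REPLACED by P1-bar (`maninFrameResidueProperR_of_sl2NeronValuesBar`); every other hypothesis of `closes` verbatim — compare
  `ManinFrameResidueProperROfReciprocityLaw.wAllExclAdditive_of_closes_of_reciprocityLaw_of_sl2NeronValuesBar` (g19, which took [REC-tower] too).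

References: [Kato2004Asterisque] Thm. 6.6 (1), (8.1.3), Thm. 9.7; [WZhang2014] Thm. 1.1; [GrossZagier1986]; [Kolyvagin1991].
-/

set_option autoImplicit false
-- the Theorems namespace of a single-conjunct summit repeats the summit name by design (D-0017)
set_option linter.dupNamespace false

noncomputable section

open Literature.NumberTheory.EllipticCurves Literature.NumberTheory.EllipticCurves.Kato2004
  Summit.BirchSwinnertonDyer.BirchSwinnertonDyer.Theorems
  Summit.BirchSwinnertonDyer.BirchSwinnertonDyer.Theorems.TypeGOrdManinUnitOfSL2NeronValuesBar
  Summit.BirchSwinnertonDyer.BirchSwinnertonDyer.Theorems.TeichmullerTwistDescentManinSideFiveSevenOfSL2NeronValuesBar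

namespace Summit.BirchSwinnertonDyer.BirchSwinnertonDyer.Theorems.WAllRungsOfSL2NeronValuesBar

section EdixhovenFibreFiveSeven

open Summit.BirchSwinnertonDyer.BirchSwinnertonDyer.Theses.EdixhovenFibreFiveSeven

/-- ★★ **The rung `WAllExclAdditiveFiveLeRankOne` (W-ALL/2.p>=5.r1) through route EdixhovenFibreFiveSeven, GRANTED ONLY P1-bar, the three AKR-shared open
Kolyvagin-side cruxes and the two published-input bundles** — `EdixhovenFibreFiveSevenAssembly.assembly_proof` (22231) fed with K★
(`…LocalFormulaOrdinaryCells.starredOptimalManinUnitFiveSeven_of_sl2NeronValuesBar`), TDS57 (`PotGoodManinUnitOfSL2NeronValuesBar.twistDegreeStepFiveSeven_of_sl2NeronValuesBar`),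
TDS11 (the LEAD's `TwistDegreeStepOrdinaryOfSL2NeronValuesBar.twistDegreeStepOrdinary_of_sl2NeronValuesBar`, p809715) and the closed glue G57 — i.e.
`PotGoodManinUnitOfSL2NeronValuesBar.wAllExclAdditiveFiveLeRankOne_of_akr_of_twistDegreeStepOrdinary_of_sl2NeronValuesBar` with its `hO` DISCHARGED mod P1-bar.
= g19's `OptimalManinUnitFiveSevenOfReciprocityLaw.wAllExclAdditiveFiveLeRankOne_of_akr_of_reciprocityLaw_of_sl2NeronValuesBar` WITHOUT `hrec`: Kato 1993 II Thm. 1.4.1 (4)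
is no longer an input of the rung. CONDITIONAL (one cite-only printed fact + three OPEN cruxes + two hypothesis-only bundles); no item is closed; BSD is not proved and
no W-ALL class theorem is proved by this. [cite: Kato2004Asterisque, Thm. 6.6 (1) (p. 163), (8.1.3) (p. 180), Thm. 9.7 (p. 189)] [cite: WZhang2014, Thm. 1.1] -/
theorem wAllExclAdditiveFiveLeRankOne_of_akr_of_sl2NeronValuesBar_viaEdixhovenFibreFiveSeven
    (hP1 : exists_member_sl2ZetaElement_neron_values_bar)
    (h₁ : KolyvaginPrimitiveAdditive) (h₀ : RankZeroAdditive) (hoff : OffSharpRankOneAdditive)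
    (hP : PublishedInputsAdditiveKoly) (hF : PublishedManinFacts) :
    Summit.BirchSwinnertonDyer.WAllExclAdditiveFiveLeRankOne :=
  PotGoodManinUnitOfSL2NeronValuesBar.wAllExclAdditiveFiveLeRankOne_of_akr_of_twistDegreeStepOrdinary_of_sl2NeronValuesBar hP1
    (TwistDegreeStepOrdinaryOfSL2NeronValuesBar.twistDegreeStepOrdinary_of_sl2NeronValuesBar hP1) h₁ h₀ hoff hP hF

end EdixhovenFibreFiveSeven

section TeichmullerTwistDescent

open Summit.BirchSwinnertonDyer.BirchSwinnertonDyer.Theses.TeichmullerTwistDescent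

/-- ★★ **The rung `WAllExclAdditiveFiveLeRankOne` (W-ALL/2.p>=5.r1) through route TeichmullerTwistDescent, GRANTED ONLY P1-bar, the three AKR-shared open
Kolyvagin-side cruxes and the two published-input bundles** — `TeichmullerTwistDescentAssembly.assembly_proof` fed with PSMU / SCMU57 ⟸ {modularity, P1-bar}
(modularity from `PublishedInputsAdditiveKoly`) and the closed Weil-type glue. No [REC-tower], no CDT, no F″, no Cremona range among the hypotheses. CONDITIONAL
(one cite-only printed fact + three OPEN cruxes + two hypothesis-only bundles); no item is closed; BSD is not proved and no W-ALL class theorem is proved by this.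
[cite: Kato2004Asterisque, Thm. 6.6 (1) (p. 163), (8.1.3) (p. 180), Thm. 9.7 (p. 189)] [cite: WZhang2014, Thm. 1.1] -/
theorem wAllExclAdditiveFiveLeRankOne_of_akr_of_sl2NeronValuesBar_viaTeichmullerTwistDescent
    (hP1 : exists_member_sl2ZetaElement_neron_values_bar)
    (h₁ : KolyvaginPrimitiveAdditive) (h₀ : RankZeroAdditive) (hoff : OffSharpRankOneAdditive)
    (hP : PublishedInputsAdditiveKoly) (hF : PublishedManinFacts) :
    Summit.BirchSwinnertonDyer.WAllExclAdditiveFiveLeRankOne :=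
  have hnf : ModularForms.exists_isNewformOf := hP.2.2.2.2.2.1
  TeichmullerTwistDescentAssembly.assembly_proof
    (principalSeriesOptimalManinUnit_of_sl2NeronValuesBar hnf hP1) (supercuspidalOptimalManinUnitFiveSeven_of_sl2NeronValuesBar hnf hP1)
    WeilTypeManinGlue.weilTypeManinGlue_proof h₁ h₀ hoff hP hF

end TeichmullerTwistDescent

section AdditiveKolyvaginRoad

open Summit.BirchSwinnertonDyer.BirchSwinnertonDyer.Theses.AdditiveKolyvaginRoad

/-- ★★ **The leaf `WAllExclAdditive` of route AdditiveKolyvaginRoad through its own deciding theorem `closes`, with crux #7 `ManinFrameResidueProperR` REPLACED by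
P1-bar** (`maninFrameResidueProperR_of_sl2NeronValuesBar`) — every other hypothesis of `closes` (the Kolyvagin-side cruxes 21400 / 20133 / 20134, `AdditiveAtThree`
20135, the published Manin / Edixhoven / Dokchitser / ČNS facts, the class and glue items, the published-input bundle and the additive Kolyvagin kernel) stays a
hypothesis verbatim; [REC-tower] is no longer among them. CONDITIONAL; no item is closed; BSD is not proved and no W-ALL class theorem is proved by this.
[cite: Kato2004Asterisque, (8.1.3) (p. 180), Thm. 9.7 (p. 189)] [cite: WZhang2014, Thm. 1.1] -/
theorem wAllExclAdditive_of_closes_of_sl2NeronValuesBar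
    (hP1 : exists_member_sl2ZetaElement_neron_values_bar)
    (h₁ : KolyvaginPrimitiveAdditive) (h₀ : RankZeroAdditive) (hoff : OffSharpRankOneAdditive) (h₃ : AdditiveAtThree)
    (e1 : EdixhovenManinNonPotOrdinary) (e2 : EdixhovenManinKodairaType) (dd : DokchitserIsogenyMinimalDiscriminant)
    (mz : MazurManinConstantOddPrimes) (au : AbbesUllmoManinConstantGoodPrimes) (c2 : CesnaviciusManinConstantAtTwo)
    (hOff : ManinFrameOffExceptionClass) (hIst : ManinFrameIstarClass) (g95 : ManinGoodOddFrameAdditiveResplitGlue)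
    (hC : CesnaviciusNeururerSahaManinDegree) (hD : ManinFrameResidueDegreeClass) (hP : PublishedInputsAdditiveKoly)
    (hK : AdditiveKolyvaginKernel) :
    Summit.BirchSwinnertonDyer.WAllExclAdditive :=
  closes h₁ h₀ hoff h₃ e1 e2 dd mz au c2 hOff hIst g95 hC hD (maninFrameResidueProperR_of_sl2NeronValuesBar hP1) hP hK

end AdditiveKolyvaginRoad

end Summit.BirchSwinnertonDyer.BirchSwinnertonDyer.Theorems.WAllRungsOfSL2NeronValuesBar

end
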